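import Summits.Ventures.CertifiedManyBodySolver.HubbardAlg.SdaDualEdgeEngine
import Summits.Ventures.CertifiedManyBodySolver.Rows.RectMarginalNodesSymTL
import HarnessLib

/-!
# SDA dual certificates, part 4 — the SYMMETRIC cone: point-group (`p4m`), spin-flip, `SU(2)` and block rows

HONEST FRAMING: first certified bounds; not a superconductivity verdict; every number certified-of-record or labelled
FLOAT.  SOUNDNESS statements only; no number is certified in this module.

Parts 1–3 (`SdaDualEdge`, `SdaDualEdgeTW`, `SdaDualEdgeEngine`) made every TRANSLATION-class SDA multiplier (TI transfers,
density / spin pins, (relocated) stability and EOM rows) a proved dual element of the tree primal `LTIRectGSNodeTW`.  The SDA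
engine's remaining token classes are POINT-GROUP transfers — `iso` (plaquette rotations) and `refl` (mirror) rows, used by
the certificates of record `23iso_*`, `24iso_*`, `33_T1+eom+refl` — and spin symmetrisation.  The tree ALREADY carries the
matching primal: `Rows.RectMarginalNodes.LTIRectSymGSNodeTW t U a b n lo` (rows: PSD, trace, window-LTI, density, spin-resolved
densities, `U(1)×U(1)` block rows, `WindowSpinFlip`, `WindowSU2`, `WindowP4m` = affine-`D₄` identification rows, local
stability for every `A` commuting with `N` (no `S^z` condition), translation data `TWDatum` AND `D₄` data `TWDatumD4`), with
PROVED transport `LTIRectSymGSNodeTW.le_energyDensity2D` / `.m3EnergyLowerRow` (`Rows/RectMarginalNodesSymTL.lean`).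

This module is the DUAL side of that node, in the shape of parts 1–2:
* `IsSymNull T` — window operators annihilated by every window matrix satisfying the EQUALITY rows (LTI, block, spin-flip,
  `SU(2)`, `p4m`); generators `IsLTINull.isSymNull`, `isSymNull_p4mTransfer γ w S hS hS' A` (THE `iso`/`refl` TRANSFER:
  `Γ(S ↪ W) A − Γ(S →(γ,w) γS+w ↪ W) A`), `isSymNull_spinFlip A`, `isSymNull_su2 A`, `isSymNull_block σ A`, closure.
* the cone `LTIRectSymGSDualTW t U a b n E` (hypotheses VERBATIM those of `LTIRectSymGSNodeTW`) with generators `of_isSymNull`,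
  `of_posSemidef`, `density`, `spin`, `stability`/`commutator` (in-window `Λ⁺ ⊆ W`, polarisation as in part 1, NO `S^z`
  condition on `A`), `stabilityTW`/`commutatorTW`/`hubbardCommutator`/`hubbardStability` (relocated rows, `Λ ⊆ W`), the
  inclusions `LTIRectDual.symGSDualTW`, `LTIRectGSDual.symGSDualTW`, and `add`/`smul_nonneg`/`sum`.
* edges: `ltiRectSymGSNodeTW_of_dualCert` (certificate ⇒ node value `c − (Σμ′)·n`), the M3 cell
  `m3EnergyLowerRow_of_dualCertSym`, and — because the symmetric node is transported through finite tori at the sector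
  densities `rectN n L / L²` — a thermodynamic-limit edge for DENSITY-UNIFORM certificates
  (`energyDensity2D_ge_of_symNode_lipschitz`, `energyDensity2D_ge_of_dualCertSym`: the certificate's `E` must be a dual element
  at every density, which is the case for all SDA generators except the explicit density pin; SDA pins density through the
  cluster potentials `μ′`, whose value `c − (Σμ′)·n′` is affine in `n′`).
Not provided (no SDA token uses them): generators for the `D₄`-relocated data `TWDatumD4`.

References: [cite: BratteliRobinsonII1997, Prop. 5.3.25]; [cite: Han2020Bootstrap, §3] (point-group identification rows).
-/

noncomputable section

open Matrix Complex Finset Filter Topology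
open scoped ComplexOrder MatrixOrder BigOperators
open Literature.Probability.LatticeModels
open Literature.MathematicalPhysics.QuantumLattice
open Literature.MathematicalPhysics.QuantumLattice.AndersonCluster
open Literature.MathematicalPhysics.QuantumLattice.HubbardWave0
open Literature.MathematicalPhysics.QuantumLattice.ThermodynamicLimit
open Summit.Ventures.CertifiedManyBodySolver.Rows.RectMarginalNodes

namespace Summit.Ventures.CertifiedManyBodySolver.HubbardAlg.SdaDualEdge

/-! ### Null elements of the symmetric equality rows -/

section SymNull

variable {W : Finset (Site 2)}

/-- `T ∈ 𝔄_W` is SYM-NULL if `Tr ρ T = 0` for every window matrix satisfying the equality rows of the symmetric node: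
window-LTI, `U(1)×U(1)` block rows, spin-flip, `SU(2)`-commutant and `p4m` rows. -/
def IsSymNull (T : FermionOp W) : Prop :=
  ∀ ρ : FermionOp W, WindowLTI ρ →
    (∀ (σ : Fin 2) (A : FermionOp W),
      (ρ * ((∑ y : PolySite W, numberOp y σ) * A - A * ∑ y : PolySite W, numberOp y σ)).trace = 0) →
    WindowSpinFlip ρ → WindowSU2 ρ → WindowP4m ρ → (ρ * T).trace = 0

/-- LTI-null elements (in particular every translation transfer, part 1) are sym-null. -/
theorem IsLTINull.isSymNull {T : FermionOp W} (hT : IsLTINull T) : IsSymNull T := fun ρ hlti _ _ _ _ => hT ρ hlti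

/-- **The point-group transfer** (`iso` / `refl` rows of the SDA engine): `Γ(S ↪ W) A − Γ(S → γS+w ↪ W) A` is sym-null
for every sub-region `S`, affine `D₄` map `x ↦ γ x + w` with `S, γ S + w ⊆ W`, and every `A ∈ 𝔄_S` (`WindowP4m`). -/
theorem isSymNull_p4mTransfer (γ : DihedralGroup 4) (w : Site 2) (S : Finset (Site 2)) (hS : S ⊆ W)
    (hS' : d4ShiftSet γ w S ⊆ W) (A : FermionOp S) :
    IsSymNull (fermionEmbed (PolySite.incl hS) A - fermionEmbed ((PolySite.d4Emb γ w S).trans (PolySite.incl hS')) A) :=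
  fun ρ _ _ _ _ hp4m => by rw [Matrix.mul_sub, Matrix.trace_sub, hp4m γ w S hS hS' A, sub_self]

/-- **The spin-flip transfer**: `Γ_swap A − A` is sym-null (`WindowSpinFlip`). -/
theorem isSymNull_spinFlip (A : FermionOp W) :
    IsSymNull (relabel (Orb.spinSwap : Orb (PolySite W) ≃ Orb (PolySite W)) A - A) :=
  fun ρ _ _ hflip _ _ => by rw [Matrix.mul_sub, Matrix.trace_sub, hflip A, sub_self]

/-- **The `SU(2)` row**: `S⁺_W A − A S⁺_W` is sym-null (`WindowSU2`). -/
theorem isSymNull_su2 (A : FermionOp W) : IsSymNull ((spinPlus : FermionOp W) * A - A * spinPlus) :=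
  fun _ _ _ _ hsu2 _ => hsu2 A

/-- **The block row**: `N_{W,σ} A − A N_{W,σ}` is sym-null (`U(1)×U(1)` sector rows). -/
theorem isSymNull_block (σ : Fin 2) (A : FermionOp W) :
    IsSymNull ((∑ y : PolySite W, numberOp y σ) * A - A * ∑ y : PolySite W, numberOp y σ) :=
  fun _ _ hblock _ _ _ => hblock σ A

/-- `0` is sym-null. -/
theorem IsSymNull.zero : IsSymNull (0 : FermionOp W) := fun ρ _ _ _ _ _ => by rw [Matrix.mul_zero, Matrix.trace_zero]

/-- Sym-null elements are closed under addition. -/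
theorem IsSymNull.add {T T' : FermionOp W} (hT : IsSymNull T) (hT' : IsSymNull T') : IsSymNull (T + T') :=
  fun ρ h1 h2 h3 h4 h5 => by
    rw [Matrix.mul_add, Matrix.trace_add, hT ρ h1 h2 h3 h4 h5, hT' ρ h1 h2 h3 h4 h5, add_zero]

/-- Sym-null elements are closed under subtraction. -/
theorem IsSymNull.sub {T T' : FermionOp W} (hT : IsSymNull T) (hT' : IsSymNull T') : IsSymNull (T - T') :=
  fun ρ h1 h2 h3 h4 h5 => by
    rw [Matrix.mul_sub, Matrix.trace_sub, hT ρ h1 h2 h3 h4 h5, hT' ρ h1 h2 h3 h4 h5, sub_zero]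

/-- Sym-null elements are closed under negation. -/
theorem IsSymNull.neg {T : FermionOp W} (hT : IsSymNull T) : IsSymNull (-T) :=
  fun ρ h1 h2 h3 h4 h5 => by rw [Matrix.mul_neg, Matrix.trace_neg, hT ρ h1 h2 h3 h4 h5, neg_zero]

/-- Sym-null elements are closed under complex scalars (multipliers of equality rows are free). -/
theorem IsSymNull.smul {T : FermionOp W} (hT : IsSymNull T) (c : ℂ) : IsSymNull (c • T) :=
  fun ρ h1 h2 h3 h4 h5 => by rw [Matrix.mul_smul, Matrix.trace_smul, hT ρ h1 h2 h3 h4 h5, smul_zero]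

/-- Sym-null elements are closed under finite sums. -/
theorem IsSymNull.sum {κ : Type*} (s : Finset κ) {T : κ → FermionOp W} (hT : ∀ k ∈ s, IsSymNull (T k)) :
    IsSymNull (∑ k ∈ s, T k) :=
  fun ρ h1 h2 h3 h4 h5 => by
    rw [Finset.mul_sum, Matrix.trace_sum]
    exact Finset.sum_eq_zero fun k hk => hT k hk ρ h1 h2 h3 h4 h5

end SymNull

/-! ### The dual cone of the symmetric term-wise node -/

section SymCone

variable (t U : ℝ) (a b : ℕ) (n : ℝ)

/-- **Dual cone of `LTIRectSymGSNodeTW t U a b n ·`**: `Re Tr ρ E ≥ 0` on every window matrix satisfying its rows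
(hypotheses copied verbatim from the node). -/
def LTIRectSymGSDualTW (E : FermionOp (rectWindow a b)) : Prop :=
  ∀ ρ : FermionOp (rectWindow a b), ρ.PosSemidef → ρ.trace = 1 → WindowLTI ρ →
    ((ρ * totalNumber).trace).re = ((a : ℝ) * b) * n →
    (∀ σ : Fin 2, ((ρ * ∑ y : PolySite (rectWindow a b), numberOp y σ).trace).re = ((a : ℝ) * b) * (n / 2)) →
    (∀ (σ : Fin 2) (A : FermionOp (rectWindow a b)),
      (ρ * ((∑ y : PolySite (rectWindow a b), numberOp y σ) * A -
        A * ∑ y : PolySite (rectWindow a b), numberOp y σ)).trace = 0) →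
    WindowSpinFlip ρ → WindowSU2 ρ → WindowP4m ρ →
    (∀ (Λ : Finset (Site 2)) (hΛ : thicken Λ 1 ⊆ rectWindow a b) (A : FermionOp Λ), Commute A totalNumber →
        0 ≤ (ρ * fermionEmbed (PolySite.incl hΛ) (stabilityObs t U Λ A)).trace) →
    (∀ Λ : Finset (Site 2), Λ ⊆ rectWindow a b → ∀ A : FermionOp Λ, Commute A totalNumber →
        ∀ D : TWDatum t U (rectWindow a b) Λ A, 0 ≤ D.row ρ) →
    (∀ Λ : Finset (Site 2), Λ ⊆ rectWindow a b → ∀ A : FermionOp Λ, Commute A totalNumber →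
        ∀ D : TWDatumD4 t U (rectWindow a b) Λ A, 0 ≤ D.row ρ) →
    0 ≤ ((ρ * E).trace).re

variable {t U a b n}

/-- More rows, bigger cone: a dual element of the LTI node is one of the symmetric node. -/
theorem LTIRectDual.symGSDualTW {E : FermionOp (rectWindow a b)} (hE : LTIRectDual a b n E) :
    LTIRectSymGSDualTW t U a b n E :=
  fun ρ h1 h2 h3 h4 _ _ _ _ _ _ _ _ => hE ρ h1 h2 h3 h4

/-- A dual element of the ground-state-class node (part 1) is one of the symmetric node (its stability rows ask less of `A`). -/
theorem LTIRectGSDual.symGSDualTW {E : FermionOp (rectWindow a b)} (hE : LTIRectGSDual t U a b n E) :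
    LTIRectSymGSDualTW t U a b n E :=
  fun ρ h1 h2 h3 h4 h5 _ _ _ _ hst _ _ => hE ρ h1 h2 h3 h4 h5 fun Λ hΛ A hN _ => hst Λ hΛ A hN

/-- Sym-null operators (point-group / spin-flip / `SU(2)` / block / translation transfers) are dual elements. -/
theorem LTIRectSymGSDualTW.of_isSymNull {T : FermionOp (rectWindow a b)} (hT : IsSymNull T) :
    LTIRectSymGSDualTW t U a b n T :=
  fun ρ _ _ hlti _ _ hblock hflip hsu2 hp4m _ _ _ => by rw [hT ρ hlti hblock hflip hsu2 hp4m, Complex.zero_re]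

/-- LTI-null operators are dual elements of the symmetric node. -/
theorem LTIRectSymGSDualTW.of_isLTINull {T : FermionOp (rectWindow a b)} (hT : IsLTINull T) :
    LTIRectSymGSDualTW t U a b n T :=
  LTIRectSymGSDualTW.of_isSymNull hT.isSymNull

/-- PSD operators (slack) are dual elements. -/
theorem LTIRectSymGSDualTW.of_posSemidef {P : FermionOp (rectWindow a b)} (hP : P.PosSemidef) :
    LTIRectSymGSDualTW t U a b n P :=
  (LTIRectDual.of_posSemidef hP).symGSDualTW

/-- The density multiplier `ν (N_W − a b n · 1)`. -/
theorem LTIRectSymGSDualTW.density (ν : ℝ) :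
    LTIRectSymGSDualTW t U a b n ((ν : ℂ) • totalNumber -
      ((ν * ((a : ℝ) * b * n) : ℝ) : ℂ) • (1 : FermionOp (rectWindow a b))) :=
  (LTIRectDual.density ν).symGSDualTW

/-- The spin-resolved density multiplier `ν (N_{W,σ} − a b n/2 · 1)`. -/
theorem LTIRectSymGSDualTW.spin (ν : ℝ) (σ : Fin 2) :
    LTIRectSymGSDualTW t U a b n ((ν : ℂ) • ∑ y : PolySite (rectWindow a b), numberOp y σ -
      ((ν * ((a : ℝ) * b * (n / 2)) : ℝ) : ℂ) • (1 : FermionOp (rectWindow a b))) :=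
  (LTIRectGSDual.spin ν σ).symGSDualTW

/-- **Stability multiplier** (in-window, `Λ⁺ ⊆ W`): `γ · Γ(Ãᴴ[H,Ã])`, `γ ≥ 0`, for every `A` commuting with `N_Λ`
(no `S^z` condition in the symmetric node). -/
theorem LTIRectSymGSDualTW.stability {Λ : Finset (Site 2)} (hΛ : thicken Λ 1 ⊆ rectWindow a b) (A : FermionOp Λ)
    (hN : Commute A totalNumber) {γ : ℝ} (hγ : 0 ≤ γ) :
    LTIRectSymGSDualTW t U a b n ((γ : ℂ) • fermionEmbed (PolySite.incl hΛ) (stabilityObs t U Λ A)) := by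
  intro ρ _ _ _ _ _ _ _ _ _ hstab _ _
  rw [Matrix.mul_smul, Matrix.trace_smul, smul_eq_mul, Complex.mul_re, Complex.ofReal_re, Complex.ofReal_im, zero_mul,
    sub_zero]
  exact mul_nonneg hγ (Complex.nonneg_iff.1 (hstab Λ hΛ A hN)).1

/-- **EOM / stationarity multiplier** (in-window): `δ · Γ([H, Ã])` for EVERY `δ ∈ ℂ`, by polarisation (part 1). -/
theorem LTIRectSymGSDualTW.commutator {Λ : Finset (Site 2)} (hΛ : thicken Λ 1 ⊆ rectWindow a b) (A : FermionOp Λ)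
    (hN : Commute A totalNumber) (δ : ℂ) :
    LTIRectSymGSDualTW t U a b n (δ • fermionEmbed (PolySite.incl hΛ) (commObs t U Λ A)) := by
  intro ρ _ _ _ _ _ _ _ _ _ hstab _ _
  have h0 := trace_commObs_eq_zero t U hΛ A fun c =>
    hstab Λ hΛ (A + c • 1) (hN.add_left ((Commute.one_left _).smul_left c))
  rw [Matrix.mul_smul, Matrix.trace_smul, h0, smul_zero, Complex.zero_re]

/-- **Relocated stability multiplier**: `γ · twOp D`, `γ ≥ 0`, for a translation datum of `(Λ ⊆ W, A)`, `[A, N_Λ] = 0`. -/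
theorem LTIRectSymGSDualTW.stabilityTW {Λ : Finset (Site 2)} (hΛW : Λ ⊆ rectWindow a b) {A : FermionOp Λ}
    (hN : Commute A totalNumber) (D : TWDatum t U (rectWindow a b) Λ A) {γ : ℝ} (hγ : 0 ≤ γ) :
    LTIRectSymGSDualTW t U a b n ((γ : ℂ) • twOp D) := by
  intro ρ _ _ _ _ _ _ _ _ _ _ htw _
  rw [Matrix.mul_smul, Matrix.trace_smul, smul_eq_mul, trace_mul_twOp, Complex.mul_re, Complex.ofReal_re,
    Complex.ofReal_im, zero_mul, sub_zero]
  exact mul_nonneg hγ (Complex.nonneg_iff.1 (htw Λ hΛW A hN D)).1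

/-- **Relocated EOM multiplier**: `δ · P.commOp` for every `δ ∈ ℂ` and any polar datum of `(Λ ⊆ W, A)`, `[A, N_Λ] = 0`. -/
theorem LTIRectSymGSDualTW.commutatorTW {Λ : Finset (Site 2)} (hΛW : Λ ⊆ rectWindow a b) {A : FermionOp Λ}
    (hN : Commute A totalNumber) (P : TWPolarDatum t U (rectWindow a b) Λ A) (δ : ℂ) :
    LTIRectSymGSDualTW t U a b n (δ • P.commOp) := by
  intro ρ _ _ _ _ _ _ _ _ _ _ htw _
  have h0 := P.trace_commOp_eq_zero ρ fun c =>
    htw Λ hΛW (A + c • 1) (hN.add_left ((Commute.one_left _).smul_left c)) (P.polarise c)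
  rw [Matrix.mul_smul, Matrix.trace_smul, h0, smul_zero, Complex.zero_re]

/-- **The SDA engine's EOM multiplier in the symmetric cone** — pure data `(Λ ⊆ W, A, v, δ)` (part 3's Hubbard datum). -/
theorem LTIRectSymGSDualTW.hubbardCommutator {Λ : Finset (Site 2)} (hΛW : Λ ⊆ rectWindow a b) {A : FermionOp Λ}
    (hN : Commute A totalNumber) (v : Finset (Site 2) → Site 2)
    (hv : ∀ X ∈ hubbardTerms Λ, shiftSet (v X) (Λ ∪ X) ⊆ rectWindow a b) (δ : ℂ) :
    LTIRectSymGSDualTW t U a b n (δ • (hubbardEngineDatum t U Λ A v hv).commOp) :=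
  LTIRectSymGSDualTW.commutatorTW hΛW hN _ δ

/-- The matching relocated stability multiplier (`γ ≥ 0`). -/
theorem LTIRectSymGSDualTW.hubbardStability {Λ : Finset (Site 2)} (hΛW : Λ ⊆ rectWindow a b) {A : FermionOp Λ}
    (hN : Commute A totalNumber) (v : Finset (Site 2) → Site 2)
    (hv : ∀ X ∈ hubbardTerms Λ, shiftSet (v X) (Λ ∪ X) ⊆ rectWindow a b) {γ : ℝ} (hγ : 0 ≤ γ) :
    LTIRectSymGSDualTW t U a b n ((γ : ℂ) • (hubbardEngineDatum t U Λ A v hv).stabOp) := by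
  rw [← TWPolarDatum.twOp_toTWDatum]
  exact LTIRectSymGSDualTW.stabilityTW hΛW hN _ hγ

/-- Closure under addition. -/
theorem LTIRectSymGSDualTW.add {E E' : FermionOp (rectWindow a b)} (hE : LTIRectSymGSDualTW t U a b n E)
    (hE' : LTIRectSymGSDualTW t U a b n E') : LTIRectSymGSDualTW t U a b n (E + E') :=
  fun ρ h1 h2 h3 h4 h5 h6 h7 h8 h9 h10 h11 h12 => by
    rw [Matrix.mul_add, Matrix.trace_add, Complex.add_re]
    exact add_nonneg (hE ρ h1 h2 h3 h4 h5 h6 h7 h8 h9 h10 h11 h12) (hE' ρ h1 h2 h3 h4 h5 h6 h7 h8 h9 h10 h11 h12)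

/-- Closure under nonnegative real scalars. -/
theorem LTIRectSymGSDualTW.smul_nonneg {E : FermionOp (rectWindow a b)} (hE : LTIRectSymGSDualTW t U a b n E) {γ : ℝ}
    (hγ : 0 ≤ γ) : LTIRectSymGSDualTW t U a b n ((γ : ℂ) • E) :=
  fun ρ h1 h2 h3 h4 h5 h6 h7 h8 h9 h10 h11 h12 => by
    rw [Matrix.mul_smul, Matrix.trace_smul, smul_eq_mul, Complex.mul_re, Complex.ofReal_re, Complex.ofReal_im,
      zero_mul, sub_zero]
    exact mul_nonneg hγ (hE ρ h1 h2 h3 h4 h5 h6 h7 h8 h9 h10 h11 h12)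

/-- Closure under finite sums. -/
theorem LTIRectSymGSDualTW.sum {κ : Type*} (s : Finset κ) {E : κ → FermionOp (rectWindow a b)}
    (hE : ∀ k ∈ s, LTIRectSymGSDualTW t U a b n (E k)) : LTIRectSymGSDualTW t U a b n (∑ k ∈ s, E k) :=
  fun ρ h1 h2 h3 h4 h5 h6 h7 h8 h9 h10 h11 h12 => by
    rw [Finset.mul_sum, Matrix.trace_sum, Complex.re_sum]
    exact Finset.sum_nonneg fun k hk => hE k hk ρ h1 h2 h3 h4 h5 h6 h7 h8 h9 h10 h11 h12

end SymCone

/-! ### Edges: certificate ⇒ symmetric node ⇒ energy rows -/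

section Edges

/-- **WEAK DUALITY into the symmetric node**: a weighted cluster `h_R(t,U,J,V,μ′)` (`Σ_∥ J = 1` per direction, `Σ V = 1`),
a dual element `E` of the symmetric cone and ONE claim `Γ_W h_R − E − c·1 ⪰ 0` give `LTIRectSymGSNodeTW t U a b n (c − (Σμ′)·n)`. -/
theorem ltiRectSymGSNodeTW_of_dualCert (t U n : ℝ) {a b : ℕ} (ha : 2 ≤ a) (hb : 2 ≤ b) (R : Finset (Site 2))
    (hR : R ⊆ rectWindow a b) (J : Site 2 → Fin 2 → ℝ) (V μ : Site 2 → ℝ) (hJ0 : bondWeightSum R J 0 = 1)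
    (hJ1 : bondWeightSum R J 1 = 1) (hV : siteWeightSum R V = 1) {E : FermionOp (rectWindow a b)}
    (hE : LTIRectSymGSDualTW t U a b n E) {c : ℝ}
    (hK : (fermionEmbed (PolySite.incl hR) (clusterHamiltonian R t U J V μ) - E -
      (c : ℂ) • (1 : FermionOp (rectWindow a b))).PosSemidef) :
    LTIRectSymGSNodeTW t U a b n (c - siteWeightSum R μ * n) :=
  fun ρ hpsd htr hlti hdens hspin hblock hflip hsu2 hp4m hstab htw htw4 =>
    re_trace_hAvg_ge_of_cert t U n ha hb R hR J V μ hJ0 hJ1 hV hK hpsd htr hlti hdens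
      (hE ρ hpsd htr hlti hdens hspin hblock hflip hsu2 hp4m hstab htw htw4)

/-- **The M3 cell of a symmetric SDA certificate** (`t = 1`, `U = 8`, `n = 7/8`, `t′ = 0`; any `a × b` window, `a, b ≥ 2`). -/
theorem m3EnergyLowerRow_of_dualCertSym {a b : ℕ} (ha : 2 ≤ a) (hb : 2 ≤ b) (R : Finset (Site 2))
    (hR : R ⊆ rectWindow a b) (J : Site 2 → Fin 2 → ℝ) (V μ : Site 2 → ℝ) (hJ0 : bondWeightSum R J 0 = 1)
    (hJ1 : bondWeightSum R J 1 = 1) (hV : siteWeightSum R V = 1) {E : FermionOp (rectWindow a b)}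
    (hE : LTIRectSymGSDualTW 1 8 a b (7 / 8) E) {c : ℝ}
    (hK : (fermionEmbed (PolySite.incl hR) (clusterHamiltonian R 1 8 J V μ) - E -
      (c : ℂ) • (1 : FermionOp (rectWindow a b))).PosSemidef) {lo : ℚ}
    (hlo : (lo : ℝ) ≤ c - siteWeightSum R μ * (7 / 8)) : M3EnergyLowerRow 0 lo :=
  ((ltiRectSymGSNodeTW_of_dualCert 1 8 (7 / 8) ha hb R hR J V μ hJ0 hJ1 hV hE hK).mono hlo).m3EnergyLowerRow ha hb

/-- The sector densities `rectN n L / L²` do not exceed `n` (`0 ≤ n`). -/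
theorem rectN_div_sq_le {n : ℝ} (hn : 0 ≤ n) {L : ℕ} (hL : 0 < L) : (rectN n L : ℝ) / (L : ℝ) ^ 2 ≤ n := by
  have hL2 : (0 : ℝ) < (L : ℝ) ^ 2 := by positivity
  rw [div_le_iff₀ hL2]
  exact rectN_le hn L

/-- The sector densities `rectN n L / L²` lie within `2/L²` of `n` from below. -/
theorem sub_lt_rectN_div_sq (n : ℝ) {L : ℕ} (hL : 0 < L) : n - 2 / (L : ℝ) ^ 2 < (rectN n L : ℝ) / (L : ℝ) ^ 2 := by
  have hL2 : (0 : ℝ) < (L : ℝ) ^ 2 := by positivity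
  rw [sub_lt_iff_lt_add, ← add_div, lt_div_iff₀ hL2]
  exact lt_rectN_add_two n L

/-- **Thermodynamic limit for DENSITY-UNIFORM symmetric node bounds.**  If for every density `n' ∈ [n − 1, n]` the node holds
with the Lipschitz-degraded value `lo − K (n − n')` (`K ≥ 0`), then `lo ≤ e(t,U,n)`: the symmetric node is transported
through finite tori at the sector densities `rectN n L / L² ∈ (n − 2/L², n]`, and the degradation vanishes along
progressions of large modulus. -/
theorem energyDensity2D_ge_of_symNode_lipschitz (t : ℝ) {U : ℝ} (hU : 0 ≤ U) {a b : ℕ} (ha : 2 ≤ a) (hb : 2 ≤ b)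
    {n : ℝ} (hn0 : 0 ≤ n) (hn2 : n < 2) {lo K : ℝ} (hK : 0 ≤ K)
    (h : ∀ n' : ℝ, n - 1 ≤ n' → n' ≤ n → LTIRectSymGSNodeTW t U a b n' (lo - K * (n - n'))) :
    lo ≤ energyDensity2D t U n := by
  refine le_of_forall_pos_lt_add fun ε hε => ?_
  -- a progression modulus `c₀ > 2` with `2 K / c₀² < ε`
  obtain ⟨c₀, hc₀⟩ := exists_nat_gt (max 2 (2 * K / ε + 1))
  have hc2 : (2 : ℝ) < c₀ := (le_max_left _ _).trans_lt hc₀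
  have hKε : 2 * K / ε + 1 < (c₀ : ℝ) := (le_max_right _ _).trans_lt hc₀
  have hc0 : 0 < c₀ := Nat.cast_pos.1 (zero_lt_two.trans hc2)
  have hc02 : (0 : ℝ) < (c₀ : ℝ) ^ 2 := by positivity
  have key : lo - 2 * K / (c₀ : ℝ) ^ 2 ≤ energyDensity2D t U n := by
    refine LTIRectSymGSNodeTW.le_energyDensity2D t hU ha hb hn0 hn2 (c := c₀) hc0 fun L hL hL3 => ?_
    have hLpos : 0 < L := by omega
    have hcL : (c₀ : ℝ) ≤ L := by exact_mod_cast Nat.le_of_dvd hLpos hL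
    have h1 : (rectN n L : ℝ) / (L : ℝ) ^ 2 ≤ n := rectN_div_sq_le hn0 hLpos
    have h2 : n - 2 / (L : ℝ) ^ 2 < (rectN n L : ℝ) / (L : ℝ) ^ 2 := sub_lt_rectN_div_sq n hLpos
    have h3 : 2 / (L : ℝ) ^ 2 ≤ 2 / (c₀ : ℝ) ^ 2 :=
      div_le_div_of_nonneg_left (by norm_num) hc02 (pow_le_pow_left₀ (Nat.cast_nonneg _) hcL 2)
    have h4 : 2 / (c₀ : ℝ) ^ 2 < 1 := by
      rw [div_lt_one hc02]
      nlinarith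
    refine (h _ (by linarith) h1).mono ?_
    have h5 : K * (n - (rectN n L : ℝ) / (L : ℝ) ^ 2) ≤ K * (2 / (c₀ : ℝ) ^ 2) :=
      mul_le_mul_of_nonneg_left (by linarith) hK
    have h6 : K * (2 / (c₀ : ℝ) ^ 2) = 2 * K / (c₀ : ℝ) ^ 2 := by ring
    linarith
  have h7 : 2 * K / (c₀ : ℝ) ^ 2 < ε := by
    rw [div_lt_iff₀ hc02]
    have h8 : 2 * K < c₀ * ε := (div_lt_iff₀ hε).1 (by linarith)
    have h9 : (c₀ : ℝ) * ε ≤ ε * (c₀ : ℝ) ^ 2 := by nlinarith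
    linarith
  linarith

/-- **SOUNDNESS of a density-uniform symmetric SDA certificate in the thermodynamic limit**: if `E` is a dual element of
the symmetric cone AT EVERY DENSITY (all SDA generators except the explicit density pin `density ν` are), then the
certificate value `c − (Σμ′)·n` bounds `e(t,U,n)` from below (`U ≥ 0`, `0 ≤ n < 2`, `a, b ≥ 2`). -/
theorem energyDensity2D_ge_of_dualCertSym (t : ℝ) {U : ℝ} (hU : 0 ≤ U) {n : ℝ} (hn0 : 0 ≤ n) (hn2 : n < 2)
    {a b : ℕ} (ha : 2 ≤ a) (hb : 2 ≤ b) (R : Finset (Site 2)) (hR : R ⊆ rectWindow a b) (J : Site 2 → Fin 2 → ℝ)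
    (V μ : Site 2 → ℝ) (hJ0 : bondWeightSum R J 0 = 1) (hJ1 : bondWeightSum R J 1 = 1) (hV : siteWeightSum R V = 1)
    {E : FermionOp (rectWindow a b)} (hE : ∀ n' : ℝ, LTIRectSymGSDualTW t U a b n' E) {c : ℝ}
    (hK : (fermionEmbed (PolySite.incl hR) (clusterHamiltonian R t U J V μ) - E -
      (c : ℂ) • (1 : FermionOp (rectWindow a b))).PosSemidef) :
    c - siteWeightSum R μ * n ≤ energyDensity2D t U n := by
  refine energyDensity2D_ge_of_symNode_lipschitz t hU ha hb hn0 hn2 (K := |siteWeightSum R μ|) (abs_nonneg _)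
    fun n' _ hn' => (ltiRectSymGSNodeTW_of_dualCert t U n' ha hb R hR J V μ hJ0 hJ1 hV (hE n') hK).mono ?_
  have h1 : -(|siteWeightSum R μ| * (n - n')) ≤ siteWeightSum R μ * (n - n') := by
    rw [← neg_mul]
    exact mul_le_mul_of_nonneg_right (neg_abs_le _) (sub_nonneg.2 hn')
  linarith

end Edges

end Summit.Ventures.CertifiedManyBodySolver.HubbardAlg.SdaDualEdge
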